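import Literature.NumberTheory.GaloisRepresentations.LocalClassFieldTheory
import HarnessLib

/-!
# Discharge of `LocalArtinData.recGL1_bijective`: local Langlands for `GL₁` (trunk GalRep, item C18)

D-0014 keeps `Literature/` sorry-free by stating cited results as named facts `def X : Prop`.
This sibling file of `Literature.NumberTheory.GaloisRepresentations.LocalClassFieldTheory` proves
the named fact `LocalArtinData.recGL1_bijective`: for every local Artin datum `d` (a continuous open
quotient map `artin : W_F → Fˣ` with kernel the closure of `[W_F, W_F]`), composition with `artin`
is a **bijection** between continuous quasi-characters `Fˣ →ₜ* ℂˣ` and continuous characters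
`W_F →ₜ* ℂˣ` (Tate, *Number theoretic background*, Corvallis 1979, (1.4.5), (2.1); Langlands,
*Problems in the theory of automorphic forms* (1970), §2: local Langlands for `GL₁`).
Injectivity is `recGL1_injective` (in `LocalClassFieldTheory`); surjectivity
(`recGL1_surjective`): a continuous character `θ` of `W_F` into the Hausdorff abelian group `ℂˣ`
kills `[W_F, W_F]` (`Abelianization.commutator_subset_ker`) and, its kernel being closed, the
closure `ker artin` (`ker_artin_le_ker`); so `θ` factors algebraically through the surjection
`artin` (Mathlib `MonoidHom.liftOfSurjective`), and the factorisation is continuous because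
`artin` is a quotient map (`IsOpenQuotientMap.isQuotientMap`, `IsQuotientMap.continuous_iff`).

## References

* J. Tate, *Number theoretic background*, Proc. Sympos. Pure Math. XXXIII (Corvallis 1977),
  Part 2, AMS 1979, (1.4.5), (2.1) (`Corvallis1979`).
-/

noncomputable section

open Topology

namespace Literature.NumberTheory.GaloisRepresentations

namespace LocalArtinData

variable {F : Type*} [Field F] [ValuativeRel F] [TopologicalSpace F] [IsNonarchimedeanLocalField F]

/-- A continuous character `θ : W_F →ₜ* ℂˣ` is trivial on `ker artin = closure [W_F, W_F]`:
`ℂˣ` is abelian (`[W_F, W_F] ≤ ker θ`) and Hausdorff (`ker θ` is closed).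
Ref: Tate, *Number theoretic background* (Corvallis 1979), (1.4.5). [cite: Corvallis1979, (1.4.5)] -/
theorem ker_artin_le_ker (d : LocalArtinData F) (θ : WeilGroup F →ₜ* ℂˣ) :
    d.artin.ker ≤ θ.toMonoidHom.ker := by
  intro w hw
  have hw' : w ∈ closure (commutator (WeilGroup F) : Set (WeilGroup F)) := by
    rw [← d.ker_artin]
    exact hw
  have hclosed : IsClosed (θ.toMonoidHom.ker : Set (WeilGroup F)) := by
    have hset : (θ.toMonoidHom.ker : Set (WeilGroup F)) = θ ⁻¹' {1} := by
      ext x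
      simp [MonoidHom.mem_ker]
    rw [hset]
    exact isClosed_singleton.preimage θ.continuous
  have hle : (commutator (WeilGroup F) : Set (WeilGroup F)) ⊆ θ.toMonoidHom.ker :=
    fun x hx => Abelianization.commutator_subset_ker θ.toMonoidHom hx
  exact closure_minimal hle hclosed hw'

/-- **`recGL1` is surjective**: every continuous character of `W_F` is `χ ∘ artin` for a
continuous quasi-character `χ` of `Fˣ` (factor through the open quotient map `artin`, whose
kernel `θ` kills).  Ref: Tate, *Number theoretic background* (Corvallis 1979), (1.4.5), (2.1).
[cite: Corvallis1979, (1.4.5)] -/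
theorem recGL1_surjective (d : LocalArtinData F) : Function.Surjective d.recGL1 := by
  intro θ
  -- algebraic factorisation through the surjection `artin`
  set χ₀ : Fˣ →* ℂˣ :=
    d.artin.liftOfSurjective d.artin_surjective ⟨θ.toMonoidHom, d.ker_artin_le_ker θ⟩ with hχ₀def
  have hχ₀ : ∀ w, χ₀ (d.artin w) = θ w := fun w =>
    d.artin.liftOfRightInverse_comp_apply _ _ ⟨θ.toMonoidHom, d.ker_artin_le_ker θ⟩ w
  -- continuity: `artin` is a quotient map and `χ₀ ∘ artin = θ` is continuous
  have hcomp : (χ₀ ∘ d.artin : WeilGroup F → ℂˣ) = θ := funext hχ₀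
  have hcont : Continuous χ₀ := by
    rw [d.isOpenQuotientMap_artin.isQuotientMap.continuous_iff, hcomp]
    exact θ.continuous
  refine ⟨⟨χ₀, hcont⟩, ContinuousMonoidHom.ext fun w => ?_⟩
  rw [recGL1_apply]
  exact hχ₀ w

/-- **Discharge of `LocalArtinData.recGL1_bijective`** — local Langlands for `GL₁`: for every
local Artin datum `d`, `χ ↦ χ ∘ artin` is a bijection between continuous quasi-characters of `Fˣ`
and continuous characters `W_F →ₜ* ℂˣ` (`recGL1_injective`, `recGL1_surjective`).
Ref: Tate, *Number theoretic background* (Corvallis 1979), (1.4.5), (2.1). [cite: Corvallis1979, (1.4.5)] -/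
theorem recGL1_bijective_holds : recGL1_bijective (F := F) :=
  fun d => ⟨d.recGL1_injective, d.recGL1_surjective⟩

end LocalArtinData

end Literature.NumberTheory.GaloisRepresentations

end
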